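import Summits.QuantumFields.YangMills.Theorems.FluctuationComparisonRegPrIntLS2BetaFlatTubeDepthOneUniformTorus
import Summits.QuantumFields.YangMills.Theorems.FluctuationComparisonRegPrIntLS2BetaClosePairOfOneStep
import Literature.MathematicalPhysics.QuantumFieldTheory.Balaban1983to89.T3Thresholds
import HarnessLib

/-!
# TUBE-REG∘ ∕ GAP♯∘ AT THE FLAT DATUM, DEPTH ONE, WITH A VOLUME-UNIFORM CONSTANT, II — the d = 3 carrier: the quadratic growth of the Wilson action about the residual orbit
# of `1` over the flat fibre `fibre_{J,J+1}(1)`, with `∃ μ(L)` BEFORE `∀ F γ K`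
# (crux `FluctuationComparisonRegPrIntL`, stmt-QuantumFields-20520; registry v11.4 `Cruxes/FluctuationComparisonRegPrIntL/Lines/semiclassical_s2beta.lean` 3732b7df FROZEN, untouched)

Cell `ym3-torus` (YM ladder rung R3 = continuum `SU(2)` Yang–Mills on the three-torus — a RUNG: NOT d = 4, NOT infinite volume, NOT a mass gap, NOT Clay).
Width seat `ym3-torus-px12` (gen 22); `--kind proof --supports stmt-QuantumFields-20520 --as helper`, count-neutral, DEFINITION-FREE (0 `def`, 0 `instance`,
0 `notation`, 0 `sorry`, default heartbeats).

WHY.  The registered growth organs GAP♯∘ (`UniformFibreGapOrbit`) and the displayed TUBE-REG∘ choose `μ` BEFORE the run: `∃ μ > 0, ∀ F γ J K V …`.  At the flat datum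
the tree's letters ✓`…S2BetaFlatGapOutright.exists_tubeGrowth_flat ∕ exists_gapFlat_flat` (px12 g21 ∘ px16 g17 bricks 1–5) have `∃ μ` AFTER `∀ F γ J K` — the constant
comes from compactness of the configuration space of run `K` and depends on the lattice VOLUME.  This file proves the volume-uniform inequality at depth `K − J = 1` from the
torus-side `ℓ²` bound of the companion ✓`…S2BetaFlatTubeDepthOneUniformTorus.sum_dist1_sq_le_of_combAxial_one` (local kinematics of [Balaban1985RegularSpaces] Lemma 1 +
ball multiplicity): the rooted comb-axial representative of a flat-fibre good history has trivial one-step averages, its block balls are below the (0.4) guard once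
`θBal ≤ θ*(L)`, and `dist1² ≤ 4(1 − reTr)` on `SU(2)` turns the plaquette square sum into the Wilson action.

WHAT.
* §4 `sum_ball_gaugeAct`, `card_plaq_ball_le`, `sum_ball_le_of_plaqSmall` (bookkeeping); ★★ `sum_dist1_sq_le_wilsonAction4_flat_oneStep` — run `K ≥ 1`, `SU(2)` field `U`
  with trivial ONE-STEP (0.4) average and `PlaqSmall θ U`, `θ` below the guard: the rooted comb-axial `v` (✓`Prop7AxialGauge.exists_axialGauge`) has
  `Σ_ℓ dist1(U ℓ·((v⁻¹ • 1) ℓ)⁻¹)² ≤ 4·C²M·wilsonAction4 U`, `C, M` functions of `d = 3`, `L` ONLY;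
  ★★★ `tubeGrowth_flat_depthOne_uniform` — `∀ L b₀ p₀, ∃ γ₁ > 0, ∃ μ > 0, ∀ F (F.L = L), ∀ 0 < γ ≤ γ₁, ∀ J ≤ K with K = J + 1, ∀ ε₀ > 0, ∀ U ∈ fibre_{J,K}(1) ∩ histGood(θBal b₀):
  μ·L^{−2(K−J)}·⨅_{w residual} Σ_ℓ dist1(U ℓ·((w • 1) ℓ)⁻¹)² ≤ wilsonAction4 U − minActionRegPr … ε₀ 1` — GAP♯∘'s body at `(V, U₀) = (1, 1)`, depth one, `μ` BEFORE the run
  (orbit functional and residual set spelled as in ✓`…S2BetaFlatGapOutright.exists_tubeGrowth_flat`; no tube clause needed at the flat datum).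

HONEST: depth ONE only (the depth-uniformity of TUBE-REG∘ — [Balaban1984PropagatorsII] (1.33), multi-scale — is NOT touched); the flat datum only (general window data
NOT touched); constants crude; lattice kinematics + Cauchy–Schwarz; nothing of Bałaban's analysis; TUBE-REG∘, GAP♯∘, EXW∘, S2β, crux 20520 NOT proved; no registered stub
is closed; rung R3 = SU(2) YM₃ on T³ — NOT d = 4, NOT infinite volume, NOT a mass gap, NOT Clay; the Yang–Mills mass gap is NOT proved.  Sorry-free, axioms standard.

References: T. Bałaban, CMP **99** (1985) 75–102 [Balaban1985RegularSpaces] (Lemma 1 (1.24)–(1.26) pp.79–80); CMP **102** (1985) 277–309 [Balaban1985Variational]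
((142) p.299, Thm 1 (8)–(10) p.279); CMP **96** (1984) 223–250 [Balaban1984PropagatorsII] ((1.33)); CMP **102** (1985) 255–275 [Balaban1985UV3] ((11) p.258, (12)–(13) p.259).
-/

set_option autoImplicit false

noncomputable section

namespace Summit.QuantumFields.YangMills.Theorems.FluctuationComparisonRegPrIntLS2BetaFlatTubeDepthOneUniform

open Finset
open Literature.MathematicalPhysics.QuantumFieldTheory.Balaban1983to89
open T4Continuum BlockAveraging AveragingRT ExpMeanLog
open B10Eq27TorusAxialLog (axialT)
open B5Eq118OneStroke (iterBlockOf)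
open B15DeterminingSets (embIter)
open B3Taylor310LocalRemainder (tdist_comm tdist_self tdist_triangle)
open T3DescentFibreTower (avgFun_one expMeanLogSU_E_one)
open Summit.QuantumFields.YangMills.Theorems.FluctuationComparisonRegPrIntLS2BetaDetRepLocalRows (card_filter_tdist_comp_le)
open Summit.QuantumFields.YangMills.Theorems.FluctuationComparisonRegPrIntLS2BetaOneStepLocalAxialBounds
open Summit.QuantumFields.YangMills.Theorems.FluctuationComparisonRegPrIntLS2BetaOneStepLocalCrossingBounds
open Summit.QuantumFields.YangMills.Theorems.FluctuationComparisonRegPrIntLS2BetaFlatTubeDepthOneUniformTorus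

/-! ## §4 At the d = 3 carrier: the flat fibre at depth one, `μ` before the run -/

section T3

open scoped Matrix.Norms.L2Operator
open T3ContinuumYM3Torus
open T3UnitLawDensityEML (ℰp)
open T3UnitScaleTilt T3TiltDescent
open T3ConstrainedMinimiser (fibre)
open T3PrintedRegularMinimiser
open T3Thresholds (exists_gamma_forall_θBal_le)
open T3MinimiserStabilityReduction (θBal_pos)
open T3DescentFibreTower (one_mem_fibre_one)
open B10Eq27TorusAxialLog (gaugeActT gaugeActT_eq_gaugeAct)
open Summit.QuantumFields.YangMills.Theorems.Prop7AxialGauge (exists_axialGauge)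
open Summit.QuantumFields.YangMills.Theorems.FluctuationComparisonRegPrIntLS2BetaClosePairOfOneStep (iter_eq_of_mem_fibre residual_of_transfUp_eq_one)

variable {P : Params}

/-- The local square sums are gauge invariant. [cite: Balaban1985Averaging, (8)-(9) p.19] -/
theorem sum_ball_gaugeAct {G : Type*} [GaugeGroup G] (v : GaugeTransf P 0 G) (U : GaugeField P 0 G) (c : Site P 0) (R : ℕ) :
    ∑ q ∈ univ.filter (fun q : Plaq P 0 => Site.tdist q.src c ≤ R), dist1 (GaugeField.plaqHol (GaugeField.gaugeAct v U) q) ^ 2 =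
      ∑ q ∈ univ.filter (fun q : Plaq P 0 => Site.tdist q.src c ≤ R), dist1 (GaugeField.plaqHol U q) ^ 2 :=
  Finset.sum_congr rfl fun q _ => by rw [T4WilsonGaugeFlatDirection.plaqHol_gaugeAct, GaugeGroup.dist1_conj]

/-- A ball of plaquettes has at most `d²(2R+1)^d` members (volume-free). [cite: Balaban1985UV3, p.258] -/
theorem card_plaq_ball_le {j : ℕ} (c : Site P j) (R : ℕ) :
    (univ.filter fun q : Plaq P j => Site.tdist q.src c ≤ R).card ≤ P.d ^ 2 * (2 * R + 1) ^ P.d := by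
  classical
  have h := card_filter_tdist_comp_le (fun q : Plaq P j => q.src) (m := P.d ^ 2) card_filter_plaq_src_eq_le c R
  refine le_trans (le_of_eq (congrArg Finset.card (Finset.filter_congr fun q _ => by rw [tdist_comm]))) h

/-- Under `PlaqSmall θ` (`θ ≥ 0`) a ball's square sum is at most `d²(2R+1)^d·θ²`. [cite: Balaban1987RG1, (0.18) p.255] -/
theorem sum_ball_le_of_plaqSmall {G : Type*} [GaugeGroup G] (U : GaugeField P 0 G) {θ : ℝ} (hU : PlaqSmall θ U) (c : Site P 0) (R : ℕ) :
    ∑ q ∈ univ.filter (fun q : Plaq P 0 => Site.tdist q.src c ≤ R), dist1 (GaugeField.plaqHol U q) ^ 2 ≤ ((P.d ^ 2 * (2 * R + 1) ^ P.d : ℕ) : ℝ) * θ ^ 2 := by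
  classical
  calc ∑ q ∈ univ.filter (fun q : Plaq P 0 => Site.tdist q.src c ≤ R), dist1 (GaugeField.plaqHol U q) ^ 2
      ≤ ∑ _q ∈ univ.filter (fun q : Plaq P 0 => Site.tdist q.src c ≤ R), θ ^ 2 :=
        Finset.sum_le_sum fun q _ => pow_le_pow_left₀ (GaugeGroup.dist1_nonneg _) (hU q).le 2
    _ = ((univ.filter fun q : Plaq P 0 => Site.tdist q.src c ≤ R).card : ℝ) * θ ^ 2 := by rw [Finset.sum_const, nsmul_eq_mul]
    _ ≤ ((P.d ^ 2 * (2 * R + 1) ^ P.d : ℕ) : ℝ) * θ ^ 2 := by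
        refine mul_le_mul_of_nonneg_right ?_ (sq_nonneg _)
        exact_mod_cast card_plaq_ball_le c R

variable (F : T3Family)

/-- ★★ **THE FLAT ONE-STEP BOUND AT THE CARRIER** — for an `SU(2)` field `U` on the finest lattice of run `K ≥ 1` whose ONE-STEP (0.4) average is trivial and whose
plaquettes are within `θ` of `1`, `θ` below the guard: the rooted comb-axial gauge `v` (✓`exists_axialGauge`, `v ≡ 1` at the block centres) satisfies
`Σ_ℓ dist1(U ℓ·((v⁻¹ • 1) ℓ)⁻¹)² ≤ 4·C²M·wilsonAction4 U` — the constant depends on `d = 3` and `L` ONLY (not on `K`).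
[cite: Balaban1985RegularSpaces, Lemma 1 (1.24)-(1.26) pp.79-80; Balaban1984PropagatorsII, (1.33); Balaban1985UV3, (11) p.258] -/
theorem sum_dist1_sq_le_wilsonAction4_flat_oneStep (K : ℕ) (hK : 1 ≤ K) (U : GaugeField (F.P K) 0 (Matrix.specialUnitaryGroup (Fin 2) ℂ))
    (havgU : (BlockAveraging.blockAvg (P := F.P K) (j := 0) ℰp).avg U = 1) {θ : ℝ} (hθ0 : 0 ≤ θ) (hUθ : PlaqSmall θ U)
    (hθ : Real.sqrt (((F.P K).d ^ 2 * (2 * (2 * (F.P K).d * (F.P K).L + (F.P K).L) + 1) ^ (F.P K).d : ℕ) : ℝ) * θ < (deltaSU (Fin 2) / (((((F.P K).d + 2) * (F.P K).L : ℕ) : ℝ) ^ 2 / 4))) :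
    ∃ v : GaugeTransf (F.P K) 0 (Matrix.specialUnitaryGroup (Fin 2) ℂ), (∀ y : Site (F.P K) 1, v (embIter 1 y) = 1) ∧
      ∑ ℓ : PBond (F.P K) 0, dist1 (U ℓ * ((GaugeField.gaugeAct (fun x => (v x)⁻¹) (1 : GaugeField (F.P K) 0 (Matrix.specialUnitaryGroup (Fin 2) ℂ))) ℓ)⁻¹) ^ 2 ≤
        4 * (2 * (((F.P K).d : ℝ) * ((F.P K).L : ℝ)) ^ 2 + 2 * (6 * (((((F.P K).d + 2) * (F.P K).L : ℕ) : ℝ) ^ 2 / 4)) + (((F.P K).d * (((F.P K).L - 1) / 2) : ℕ) : ℝ) * (4 * (((F.P K).d : ℝ) * ((F.P K).L : ℝ)) ^ 2 + 2)) ^ 2 * (((F.P K).d * (2 * (2 * (F.P K).d * (F.P K).L + (F.P K).L + (F.P K).d * (F.P K).L) + 1) ^ (F.P K).d : ℕ) : ℝ) * wilsonAction4 U := by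
  classical
  have hk : 1 ≤ (F.P K).m + (F.P K).K := by show 1 ≤ F.m + K; omega
  obtain ⟨v, hv1, hax⟩ := exists_axialGauge (P := F.P K) (k := 1) hk (1 : GaugeField (F.P K) 0 (Matrix.specialUnitaryGroup (Fin 2) ℂ)) U
  refine ⟨v, hv1, ?_⟩
  set W : GaugeField (F.P K) 0 (Matrix.specialUnitaryGroup (Fin 2) ℂ) := GaugeField.gaugeAct v U with hW
  have haxW : ∀ x : Site (F.P K) 0, axialT W (embIter 1 (iterBlockOf 1 x)) x =
      axialT (1 : GaugeField (F.P K) 0 (Matrix.specialUnitaryGroup (Fin 2) ℂ)) (embIter 1 (iterBlockOf 1 x)) x := by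
    intro x; rw [hW, ← gaugeActT_eq_gaugeAct]; exact hax x
  -- trivial one-step averages of `W`
  have hvemb : (fun y : Site (F.P K) 1 => v (emb y)) = fun _ => 1 := funext fun y => hv1 y
  have havgW : avgFun ℰp W = 1 := by
    rw [← BlockAveraging.blockAvg_avg, hW, (BlockAveraging.blockAvg (P := F.P K) (j := 0) ℰp).covariant hk v U, hvemb, havgU]
    exact B12RTGaugeInvariance254.gaugeAct_one' _
  -- plaquettes of `W` = plaquettes of `U`; the guard at every block ball
  have hSW : ∀ y : Site (F.P K) 1, Real.sqrt (∑ q ∈ univ.filter (fun q : Plaq (F.P K) 0 => Site.tdist q.src (emb y) ≤ 2 * (F.P K).d * (F.P K).L + (F.P K).L),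
      dist1 (GaugeField.plaqHol W q) ^ 2) < (deltaSU (Fin 2) / (((((F.P K).d + 2) * (F.P K).L : ℕ) : ℝ) ^ 2 / 4)) := by
    intro y
    rw [hW, sum_ball_gaugeAct]
    have hle := sum_ball_le_of_plaqSmall U hUθ (emb y) (2 * (F.P K).d * (F.P K).L + (F.P K).L)
    have hsq : Real.sqrt (∑ q ∈ univ.filter (fun q : Plaq (F.P K) 0 => Site.tdist q.src (emb y) ≤ 2 * (F.P K).d * (F.P K).L + (F.P K).L),
        dist1 (GaugeField.plaqHol U q) ^ 2) ≤ Real.sqrt (((F.P K).d ^ 2 * (2 * (2 * (F.P K).d * (F.P K).L + (F.P K).L) + 1) ^ (F.P K).d : ℕ) : ℝ) * θ := by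
      rw [← Real.sqrt_sq hθ0, ← Real.sqrt_mul (Nat.cast_nonneg _)]
      exact Real.sqrt_le_sqrt hle
    exact hsq.trans_lt hθ
  have hsum := sum_dist1_sq_le_of_combAxial_one hk W haxW havgW hSW
  -- back to `U`: `dist1(U ℓ·((v⁻¹•1) ℓ)⁻¹) = dist1(W ℓ)`
  have hconj : ∀ ℓ : PBond (F.P K) 0,
      dist1 (U ℓ * ((GaugeField.gaugeAct (fun x => (v x)⁻¹) (1 : GaugeField (F.P K) 0 (Matrix.specialUnitaryGroup (Fin 2) ℂ))) ℓ)⁻¹) = dist1 (W ℓ) := by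
    intro ℓ
    have h : U ℓ * ((GaugeField.gaugeAct (fun x => (v x)⁻¹) (1 : GaugeField (F.P K) 0 (Matrix.specialUnitaryGroup (Fin 2) ℂ))) ℓ)⁻¹ =
        (v ℓ.src)⁻¹ * W ℓ * ((v ℓ.src)⁻¹)⁻¹ := by
      rw [hW]
      show U ℓ * ((v ℓ.src)⁻¹ * 1 * ((v ℓ.tgt)⁻¹)⁻¹)⁻¹ = (v ℓ.src)⁻¹ * (v ℓ.src * U ℓ * (v ℓ.tgt)⁻¹) * ((v ℓ.src)⁻¹)⁻¹
      group
    rw [h, GaugeGroup.dist1_conj]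
  simp_rw [hconj]
  have hA := sum_dist1_sq_plaq_le_four_mul_wilsonAction4 W
  have hAW : wilsonAction4 W = wilsonAction4 U := by
    rw [hW]; exact FluctuationComparisonRegPrIntLS2BetaResidualGauge.wilsonAction4_gaugeAct F v U
  have hC0 : (0 : ℝ) ≤ (2 * (((F.P K).d : ℝ) * ((F.P K).L : ℝ)) ^ 2 + 2 * (6 * (((((F.P K).d + 2) * (F.P K).L : ℕ) : ℝ) ^ 2 / 4)) + (((F.P K).d * (((F.P K).L - 1) / 2) : ℕ) : ℝ) * (4 * (((F.P K).d : ℝ) * ((F.P K).L : ℝ)) ^ 2 + 2)) ^ 2 * (((F.P K).d * (2 * (2 * (F.P K).d * (F.P K).L + (F.P K).L + (F.P K).d * (F.P K).L) + 1) ^ (F.P K).d : ℕ) : ℝ) := by positivity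
  calc ∑ ℓ : PBond (F.P K) 0, dist1 (W ℓ) ^ 2
      ≤ (2 * (((F.P K).d : ℝ) * ((F.P K).L : ℝ)) ^ 2 + 2 * (6 * (((((F.P K).d + 2) * (F.P K).L : ℕ) : ℝ) ^ 2 / 4)) + (((F.P K).d * (((F.P K).L - 1) / 2) : ℕ) : ℝ) * (4 * (((F.P K).d : ℝ) * ((F.P K).L : ℝ)) ^ 2 + 2)) ^ 2 * (((F.P K).d * (2 * (2 * (F.P K).d * (F.P K).L + (F.P K).L + (F.P K).d * (F.P K).L) + 1) ^ (F.P K).d : ℕ) : ℝ) * ∑ q : Plaq (F.P K) 0, dist1 (GaugeField.plaqHol W q) ^ 2 := by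
        have h := hsum; simpa only [mul_assoc] using h
    _ ≤ (2 * (((F.P K).d : ℝ) * ((F.P K).L : ℝ)) ^ 2 + 2 * (6 * (((((F.P K).d + 2) * (F.P K).L : ℕ) : ℝ) ^ 2 / 4)) + (((F.P K).d * (((F.P K).L - 1) / 2) : ℕ) : ℝ) * (4 * (((F.P K).d : ℝ) * ((F.P K).L : ℝ)) ^ 2 + 2)) ^ 2 * (((F.P K).d * (2 * (2 * (F.P K).d * (F.P K).L + (F.P K).L + (F.P K).d * (F.P K).L) + 1) ^ (F.P K).d : ℕ) : ℝ) * (4 * wilsonAction4 U) := by rw [← hAW]; exact mul_le_mul_of_nonneg_left hA hC0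
    _ = 4 * (2 * (((F.P K).d : ℝ) * ((F.P K).L : ℝ)) ^ 2 + 2 * (6 * (((((F.P K).d + 2) * (F.P K).L : ℕ) : ℝ) ^ 2 / 4)) + (((F.P K).d * (((F.P K).L - 1) / 2) : ℕ) : ℝ) * (4 * (((F.P K).d : ℝ) * ((F.P K).L : ℝ)) ^ 2 + 2)) ^ 2 * (((F.P K).d * (2 * (2 * (F.P K).d * (F.P K).L + (F.P K).L + (F.P K).d * (F.P K).L) + 1) ^ (F.P K).d : ℕ) : ℝ) * wilsonAction4 U := by ring

/-- ★★★ **TUBE-REG∘ ∕ GAP♯∘ AT THE FLAT DATUM, DEPTH ONE, VOLUME-UNIFORM `μ`**: for every `L`, `b₀ > 0`, `p₀ > 0` there are `γ₁ > 0` and `μ > 0` — chosen BEFORE the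
family, the coupling and the run — such that for every family with `F.L = L`, every `0 < γ ≤ γ₁`, every pair of levels `J ≤ K` with `K = J + 1`, every `ε₀ > 0` and every good
history `U` of the flat fibre `fibre_{J,K}(1)`: `μ·L^{−2(K−J)}·⨅_{w residual} Σ_ℓ dist1(U ℓ·((w • 1) ℓ)⁻¹)² ≤ wilsonAction4 U − minActionRegPr … ε₀ 1` (the orbit functional and
the residual set spelled as in ✓`…S2BetaFlatGapOutright.exists_tubeGrowth_flat`; no tube clause is needed at the flat datum).
[cite: Balaban1985Variational, (142) p.299, Thm 1 (8)-(10) p.279; Balaban1984PropagatorsII, (1.33); Balaban1985RegularSpaces, Lemma 1 (1.24)-(1.26) pp.79-80] -/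
theorem tubeGrowth_flat_depthOne_uniform (L : ℕ) (b₀ p₀ : ℝ) (hb : 0 < b₀) (hp : 0 < p₀) :
    ∃ γ₁ : ℝ, 0 < γ₁ ∧ ∃ μ : ℝ, 0 < μ ∧ ∀ (F : T3Family) (γ : ℝ), F.L = L → 0 < γ → γ ≤ γ₁ →
      ∀ (J K : ℕ) (hJK : J ≤ K), K = J + 1 → ∀ (ε₀ : ℝ), 0 < ε₀ →
        ∀ U ∈ fibre F ℰp J K hJK (1 : GaugeField (F.P J) 0 (Matrix.specialUnitaryGroup (Fin 2) ℂ)), U ∈ histGood F ℰp (θBal F.L γ b₀ p₀) K J →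
          μ * ((F.L : ℝ)⁻¹) ^ (2 * (K - J)) *
          (⨅ w : {w : Site (F.P K) 0 → Matrix.specialUnitaryGroup (Fin 2) ℂ |
          ∀ U : GaugeField (F.P K) 0 (Matrix.specialUnitaryGroup (Fin 2) ℂ),
          descendTo F ℰp J K hJK (GaugeField.gaugeAct w U) = descendTo F ℰp J K hJK U},
          ∑ ℓ : PBond (F.P K) 0,
          dist1 (U ℓ * ((GaugeField.gaugeAct (w : Site (F.P K) 0 → Matrix.specialUnitaryGroup (Fin 2) ℂ) (1 : GaugeField (F.P K) 0 (Matrix.specialUnitaryGroup (Fin 2) ℂ))) ℓ)⁻¹) ^ 2)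
          ≤ wilsonAction4 U - minActionRegPr F J K hJK ε₀ (1 : GaugeField (F.P J) 0 (Matrix.specialUnitaryGroup (Fin 2) ℂ)) := by
  classical
  rcases Nat.eq_zero_or_pos L with hL0 | hLpos
  · -- `L = 0` carries no family: any positive constants
    subst hL0
    exact ⟨1, one_pos, 1, one_pos, fun F γ hFL => absurd hFL (by have := F.hL.2; omega)⟩
  -- the guard threshold `θ*` and the coupling
  have ht0 : (0 : ℝ) < (deltaSU (Fin 2) / ((((3 + 2) * L : ℕ) : ℝ) ^ 2 / 4)) := by
    have hδ := ExpMeanLog.deltaSU_pos (n := Fin 2)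
    have : (0 : ℝ) < ((((3 + 2) * L : ℕ) : ℝ)) := by exact_mod_cast Nat.mul_pos (by norm_num) hLpos
    positivity
  set θs : ℝ := (deltaSU (Fin 2) / ((((3 + 2) * L : ℕ) : ℝ) ^ 2 / 4)) / (Real.sqrt ((3 ^ 2 * (2 * (2 * 3 * L + L) + 1) ^ 3 : ℕ) : ℝ) + 1) with hθs
  have hθs0 : 0 < θs := div_pos ht0 (by positivity)
  obtain ⟨γ₁, hγ₁, hγ₁1, hθ⟩ := exists_gamma_forall_θBal_le (b₀ := b₀) (p₀ := p₀) hb hp hθs0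
  have hCpos : (0 : ℝ) < 4 * (2 * ((3 : ℝ) * (L : ℝ)) ^ 2 + 2 * (6 * ((((3 + 2) * L : ℕ) : ℝ) ^ 2 / 4)) + ((3 * ((L - 1) / 2) : ℕ) : ℝ) * (4 * ((3 : ℝ) * (L : ℝ)) ^ 2 + 2)) ^ 2 * ((3 * (2 * (2 * 3 * L + L + 3 * L) + 1) ^ 3 : ℕ) : ℝ) + 1 := by positivity
  have hLr : (0 : ℝ) < L := by exact_mod_cast hLpos
  refine ⟨γ₁, hγ₁, (L : ℝ) ^ 2 / (4 * (2 * ((3 : ℝ) * (L : ℝ)) ^ 2 + 2 * (6 * ((((3 + 2) * L : ℕ) : ℝ) ^ 2 / 4)) + ((3 * ((L - 1) / 2) : ℕ) : ℝ) * (4 * ((3 : ℝ) * (L : ℝ)) ^ 2 + 2)) ^ 2 * ((3 * (2 * (2 * 3 * L + L + 3 * L) + 1) ^ 3 : ℕ) : ℝ) + 1), div_pos (by positivity) hCpos, ?_⟩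
  intro F γ hFL hγ hγle J K hJK hKJ ε₀ hε₀ U hU hUg
  have hKJ1 : K - J = 1 := by omega
  have hK : 1 ≤ K := by omega
  have hL1 : 1 ≤ F.L := F.hL.2.le
  have hd : (F.P K).d = 3 := T3Family.P_d F K
  have hPL : (F.P K).L = L := by rw [← hFL]; rfl
  -- the finest plaquettes of a good history
  have hUθ : PlaqSmall (θBal F.L γ b₀ p₀ K) U := by
    have h := hUg 0 (by omega)
    exact h
  have hθle : θBal F.L γ b₀ p₀ K ≤ θs := hθ F.L hL1 γ hγ hγle K
  have hθ0 : 0 ≤ θBal F.L γ b₀ p₀ K := (θBal_pos hL1 hγ (hγle.trans hγ₁1) hb p₀ K).le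
  -- the one-step average of `U` is trivial
  have havgU : (BlockAveraging.blockAvg (P := F.P K) (j := 0) ℰp).avg U = 1 := by
    have h := iter_eq_of_mem_fibre F hJK hU (one_mem_fibre_one F ℰp T3DescentFibreTower.expMeanLogSU_E_one hJK)
    rw [hKJ1] at h
    have h' : (BlockAveraging.blockAvg (P := F.P K) (j := 0) ℰp).avg U =
        (BlockAveraging.blockAvg (P := F.P K) (j := 0) ℰp).avg 1 := h
    rw [h', BlockAveraging.blockAvg_avg, avgFun_one _ T3DescentFibreTower.expMeanLogSU_E_one]
  -- the guard in the carrier's letters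
  have hguard : Real.sqrt (((F.P K).d ^ 2 * (2 * (2 * (F.P K).d * (F.P K).L + (F.P K).L) + 1) ^ (F.P K).d : ℕ) : ℝ) * θBal F.L γ b₀ p₀ K < (deltaSU (Fin 2) / (((((F.P K).d + 2) * (F.P K).L : ℕ) : ℝ) ^ 2 / 4)) := by
    rw [hd, hPL]
    have hsq0 : 0 ≤ Real.sqrt ((3 ^ 2 * (2 * (2 * 3 * L + L) + 1) ^ 3 : ℕ) : ℝ) := Real.sqrt_nonneg _
    calc Real.sqrt ((3 ^ 2 * (2 * (2 * 3 * L + L) + 1) ^ 3 : ℕ) : ℝ) * θBal F.L γ b₀ p₀ K ≤ Real.sqrt ((3 ^ 2 * (2 * (2 * 3 * L + L) + 1) ^ 3 : ℕ) : ℝ) * θs := mul_le_mul_of_nonneg_left hθle hsq0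
      _ < (deltaSU (Fin 2) / ((((3 + 2) * L : ℕ) : ℝ) ^ 2 / 4)) := by
          rw [hθs, mul_div_assoc', div_lt_iff₀ (by positivity)]
          nlinarith
  obtain ⟨v, hv1, hsum⟩ := sum_dist1_sq_le_wilsonAction4_flat_oneStep F K hK U havgU hθ0 hUθ hguard
  rw [hd, hPL] at hsum
  -- `v⁻¹` is residual
  have hres : ∀ U'' : GaugeField (F.P K) 0 (Matrix.specialUnitaryGroup (Fin 2) ℂ),
      descendTo F ℰp J K hJK (GaugeField.gaugeAct (fun x => (v x)⁻¹) U'') = descendTo F ℰp J K hJK U'' := by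
    refine residual_of_transfUp_eq_one F hJK ?_
    rw [hKJ1]
    funext y
    show (v (emb y))⁻¹ = 1
    rw [show v (emb y) = 1 from hv1 y, inv_one]
  -- the infimum is below the value at `v⁻¹`
  have hinf : (⨅ w : {w : Site (F.P K) 0 → Matrix.specialUnitaryGroup (Fin 2) ℂ |
          ∀ U : GaugeField (F.P K) 0 (Matrix.specialUnitaryGroup (Fin 2) ℂ),
          descendTo F ℰp J K hJK (GaugeField.gaugeAct w U) = descendTo F ℰp J K hJK U},
          ∑ ℓ : PBond (F.P K) 0,
          dist1 (U ℓ * ((GaugeField.gaugeAct (w : Site (F.P K) 0 → Matrix.specialUnitaryGroup (Fin 2) ℂ) (1 : GaugeField (F.P K) 0 (Matrix.specialUnitaryGroup (Fin 2) ℂ))) ℓ)⁻¹) ^ 2)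
      ≤ ∑ ℓ : PBond (F.P K) 0, dist1 (U ℓ * ((GaugeField.gaugeAct (fun x => (v x)⁻¹) (1 : GaugeField (F.P K) 0 (Matrix.specialUnitaryGroup (Fin 2) ℂ))) ℓ)⁻¹) ^ 2 := by
    refine ciInf_le ⟨0, ?_⟩ (⟨fun x => (v x)⁻¹, hres⟩ : {w : Site (F.P K) 0 → Matrix.specialUnitaryGroup (Fin 2) ℂ |
          ∀ U : GaugeField (F.P K) 0 (Matrix.specialUnitaryGroup (Fin 2) ℂ),
          descendTo F ℰp J K hJK (GaugeField.gaugeAct w U) = descendTo F ℰp J K hJK U})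
    rintro _ ⟨w, rfl⟩
    exact Finset.sum_nonneg fun _ _ => sq_nonneg _
  rw [minActionRegPr_one F hε₀, sub_zero, hKJ1, hFL]
  have hA0 : 0 ≤ wilsonAction4 U := wilsonAction4_nonneg U
  have hkey : (L : ℝ) ^ 2 / (4 * (2 * ((3 : ℝ) * (L : ℝ)) ^ 2 + 2 * (6 * ((((3 + 2) * L : ℕ) : ℝ) ^ 2 / 4)) + ((3 * ((L - 1) / 2) : ℕ) : ℝ) * (4 * ((3 : ℝ) * (L : ℝ)) ^ 2 + 2)) ^ 2 * ((3 * (2 * (2 * 3 * L + L + 3 * L) + 1) ^ 3 : ℕ) : ℝ) + 1) * ((L : ℝ)⁻¹) ^ (2 * 1) *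
      (∑ ℓ : PBond (F.P K) 0, dist1 (U ℓ * ((GaugeField.gaugeAct (fun x => (v x)⁻¹) (1 : GaugeField (F.P K) 0 (Matrix.specialUnitaryGroup (Fin 2) ℂ))) ℓ)⁻¹) ^ 2)
      ≤ wilsonAction4 U := by
    have hLne : (L : ℝ) ≠ 0 := hLr.ne'
    have hfac : (L : ℝ) ^ 2 / (4 * (2 * ((3 : ℝ) * (L : ℝ)) ^ 2 + 2 * (6 * ((((3 + 2) * L : ℕ) : ℝ) ^ 2 / 4)) + ((3 * ((L - 1) / 2) : ℕ) : ℝ) * (4 * ((3 : ℝ) * (L : ℝ)) ^ 2 + 2)) ^ 2 * ((3 * (2 * (2 * 3 * L + L + 3 * L) + 1) ^ 3 : ℕ) : ℝ) + 1) * ((L : ℝ)⁻¹) ^ (2 * 1) = 1 / (4 * (2 * ((3 : ℝ) * (L : ℝ)) ^ 2 + 2 * (6 * ((((3 + 2) * L : ℕ) : ℝ) ^ 2 / 4)) + ((3 * ((L - 1) / 2) : ℕ) : ℝ) * (4 * ((3 : ℝ) * (L : ℝ)) ^ 2 + 2)) ^ 2 * ((3 * (2 * (2 * 3 * L + L + 3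 * L) + 1) ^ 3 : ℕ) : ℝ) + 1) := by
      have hL2 : (L : ℝ) ^ 2 ≠ 0 := pow_ne_zero _ hLne
      rw [mul_one, inv_pow, div_mul_eq_mul_div, mul_inv_cancel₀ hL2]
    rw [hfac, one_div, inv_mul_le_iff₀ hCpos]
    have hA0' : 0 ≤ wilsonAction4 U := wilsonAction4_nonneg U
    linarith [hsum]
  refine le_trans ?_ hkey
  refine mul_le_mul_of_nonneg_left hinf ?_
  positivity

end T3

end Summit.QuantumFields.YangMills.Theorems.FluctuationComparisonRegPrIntLS2BetaFlatTubeDepthOneUniform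

end
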